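import Mathlib.Order.Closure
import Literature.IUT.LogVolume.TensorPacketVolume
import Literature.IUT.LogVolume.LanaHullSpan
import HarnessLib

/-!
# The holomorphic hull on a tensor packet `V = ⊗_{ℚ_p} k_i`, intrinsically: the `(R_I)^∼`-span

[IUTchIII] Rmk. 3.9.5 (i) (Mochizuki, *Inter-universal Teichmüller theory III*, RIMS ms May 2020, p. 127)
defines the holomorphic hull of a (relatively compact) region of a tensor packet of local fields as the
smallest set of the form `λ·𝒪` containing it; Dupuy–Hilado, arXiv:2004.13228, §4.12 (p. 16): "Let
`L = L_1 ⊕ ⋯ ⊕ L_s` be a product of local fields. The hull of `Ω ⊂ L` is then defined to be the smallest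
polydisc containing `Ω`", Rmk. 4.12.1: "regions like the local factors of `U_Θ` do not have module
structures. The hull construction repairs this by taking the smallest possible module containing this
regions"; LANA report §5.2 (d) (p. 29): "the holomorphic hull of `S` … is the smallest `VC(O)`-submodule of
`VC(K)` that contains `S`". Those three descriptions were CONSTRUCTED and IDENTIFIED on products
`Π_j K_j` of local fields in `HolomorphicHull.lean` (`holomorphicHull`, `polydisc`) and `LanaHullSpan.lean`
(`lanaHull`, `lanaHull_eq_holomorphicHull` on bounded sets) of this directory (abc-iut-S2, gen 0).

THIS FILE gives the hull DIRECTLY on the tensor packet `V = PacketAlgebra p k = ⨂[ℚ_p] k_i` of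
`TensorPacketRing.lean` (abc-iut-S1), with NO choice of decomposition: the integral structure of `V` is
`(R_I)^∼ = normalizedPacket p k` ([IUTchIV] Prop. 1.1; Dupuy–Hilado §2.4.5 "integral structure" `O_{v⃗}`),
`V` is an `(R_I)^∼`-module by multiplication, and

* `packetHull p k : ClosureOperator (Set V)`, `S ↦ (R_I)^∼·span(S)` — the smallest `(R_I)^∼`-submodule of
  `V` containing `S` (`packetHull_apply`, `subset_packetHull`, `isLeast_packetHull`);
* `packetHull_coe_submodule` — a submodule is its own hull; in particular (`packetHull_smul_normalizedPacket`,
  `packetHull_subset_smul_normalizedPacket`) every TRANSLATE `c·(R_I)^∼` — the containers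
  `p^λ·(R_I)^∼`, `p^{⌊λ−d_I−a_I⌋−b_I}·(R_I)^∼` of [IUTchIV] Props. 1.1–1.4 — is hull-closed, so the hull of
  ANY region inside such a translate stays inside it: the form in which [IUTchIV] Thm. 1.10 Step (v)
  (p. 27–28: "an upper bound on the component of the log-volume of the holomorphic hull … may be obtained
  by computing an upper bound for the log-volume of the right-hand side of the inclusion
  `p^{⌊λ−d_I−a_I⌋}·log_p(R_I^×) ⊆ p^{⌊λ−d_I−a_I⌋−b_I}·(R_I)^∼`") uses the hull
  (`packetHull_subset_of_subset_of_subset`, `packetHull_iUnion_subset`);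
* THE BRIDGE: for ANY decomposition `ψ : V ≃ₐ[ℚ_p] Π_j L_j` into local fields (it exists,
  `PacketDecomposition.exists_packetDecomposition`, abc-iut-S8; `ψ((R_I)^∼) = Π_j 𝒪_{L_j}`,
  `TensorPacketVolume.image_normalizedPacket`): `image_packetHull_eq_lanaHull` —
  `ψ(packetHull S) = lanaHull(ψ(S))` (LANA's smallest `VC(O)`-submodule) for every `S`, and
  `image_packetHull_eq_holomorphicHull` — `= holomorphicHull(ψ(S))` ([IUTchIII]'s smallest `λ·𝒪` =
  Dupuy–Hilado's smallest polydisc) for bounded `ψ(S)`. So `packetHull` IS the printed hull ON RELATIVELY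
  COMPACT (bounded) `S`, read on `V` itself; a packet model indexed by tensor packets can take it as its
  local hull operator (the field `hullLoc` of `IndPacketModel`, `MultiradialRegion.lean`, abc-iut-c312-3).
  SCOPE CAVEAT (read on the page, [IUTchIII] Rmk. 3.9.5 (i) p. 127 l. 5–22): print defines the hull only
  for `U` "relatively compact" and sets "If `U` is not relatively compact, then we define the holomorphic
  hull of `U` to be `ℐ^ℚ(−)`" (the whole packet; `HolomorphicHull.holomorphicHull_of_not_isBounded`), whereas
  `packetHull S` is the `(R_I)^∼`-span for EVERY `S` — for unbounded `S` the two can differ as sets (e.g.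
  `S = ψ⁻¹(L₁ ⊕ 𝒪_{L₂})` is its own span but not the whole packet); both then have infinite Haar measure, so
  no log-volume statement distinguishes them (audit note R7-S2-N1, abc-iut-L6-t24).

[cite: Mochizuki2012, IUTchIII Rmk. 3.9.5 (i) p. 127] [cite: DupuyHilado2025, §4.12 p. 16, Rmk. 4.12.1]
[cite: LANA2026Report, §5.2 (d) p. 29] Deliberately NOT here: volumes of hulls (the hull of a region inside
`c·(R_I)^∼` is measured by `c·(R_I)^∼`, `TensorPacketVolume`/`LogVolumeEstimates`, abc-iut-S8), the
(Ind1)/(Ind2)/(Ind3) regions, any judgement on [IUTchIII] Cor. 3.12. Typed ≠ endorsed.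
-/

noncomputable section

open Set
open scoped Pointwise TensorProduct

namespace Literature.IUT.LogVolume

variable (p : ℕ) [Fact p.Prime]
variable {I : Type}
variable (k : I → Type) [∀ i, NontriviallyNormedField (k i)] [∀ i, NormedAlgebra ℚ_[p] (k i)]

/-! ## `V` as an `(R_I)^∼`-module; the span closure operator -/

/-- The `(R_I)^∼`-span of a subset of `V = ⊗ k_i`: the smallest `(R_I)^∼`-submodule of `V` containing it
("the smallest possible module containing this regions", Dupuy–Hilado Rmk. 4.12.1; LANA §5.2 (d) "the
smallest `VC(O)`-submodule … that contains `S`"). [cite: DupuyHilado2025, Rmk. 4.12.1 p. 16] -/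
def packetSpan (S : Set (PacketAlgebra p k)) :
    Submodule (normalizedPacket p k) (PacketAlgebra p k) :=
  Submodule.span (normalizedPacket p k) S

/-- **The holomorphic hull on the tensor packet `V`**, as a closure operator on subsets of `V`:
`hull(S) :=` the underlying set of the `(R_I)^∼`-span of `S`. This is [IUTchIII] Rmk. 3.9.5 (i)'s hull (the
smallest `λ·𝒪 ⊇ S`) exactly on relatively compact `S` (`image_packetHull_eq_holomorphicHull`); for `S` not
relatively compact print sets the hull to be the whole packet `ℐ^ℚ(−)` while this is still the span — both
of infinite volume. [cite: Mochizuki2012, IUTchIII Rmk. 3.9.5 (i) p. 127] -/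
def packetHull : ClosureOperator (Set (PacketAlgebra p k)) :=
  ClosureOperator.mk' (fun S => (packetSpan p k S : Set (PacketAlgebra p k)))
    (fun _ _ h => Submodule.span_mono h)
    (fun _ => Submodule.subset_span)
    (fun _ => SetLike.coe_subset_coe.mpr (Submodule.span_le.mpr fun _ hx => hx))

/-- `hull(S)` is (the underlying set of) the `(R_I)^∼`-span of `S`. [cite: Mochizuki2012, IUTchIII Rmk. 3.9.5 (i) p. 127] -/
theorem packetHull_apply (S : Set (PacketAlgebra p k)) :
    packetHull p k S = (packetSpan p k S : Set (PacketAlgebra p k)) := rfl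

/-- `S ⊆ hull(S)`. [cite: Mochizuki2012, IUTchIII Rmk. 3.9.5 (ii) p. 127] -/
theorem subset_packetHull (S : Set (PacketAlgebra p k)) : S ⊆ packetHull p k S :=
  (packetHull p k).le_closure S

/-- `hull` is monotone. [cite: Mochizuki2012, IUTchIII Rmk. 3.9.5 (ii) p. 127] -/
theorem packetHull_mono {S T : Set (PacketAlgebra p k)} (h : S ⊆ T) : packetHull p k S ⊆ packetHull p k T :=
  (packetHull p k).monotone h

/-- `hull(hull(S)) = hull(S)`. [cite: Mochizuki2012, IUTchIII Rmk. 3.9.5 (ii) p. 127] -/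
theorem packetHull_packetHull (S : Set (PacketAlgebra p k)) :
    packetHull p k (packetHull p k S) = packetHull p k S :=
  (packetHull p k).idempotent S

/-- **A submodule is its own hull**: for an `(R_I)^∼`-submodule `M` of `V`, `hull(M) = M`.
[cite: DupuyHilado2025, Rmk. 4.12.1 p. 16] -/
theorem packetHull_coe_submodule (M : Submodule (normalizedPacket p k) (PacketAlgebra p k)) :
    packetHull p k (M : Set (PacketAlgebra p k)) = M := by
  rw [packetHull_apply, packetSpan, Submodule.span_eq]

/-- The hull of `S` lies in every `(R_I)^∼`-submodule containing `S`.
[cite: DupuyHilado2025, Rmk. 4.12.1 p. 16] -/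
theorem packetHull_subset_of_subset_submodule {S : Set (PacketAlgebra p k)}
    {M : Submodule (normalizedPacket p k) (PacketAlgebra p k)} (h : S ⊆ M) :
    packetHull p k S ⊆ M := by
  rw [packetHull_apply, packetSpan]
  exact Submodule.span_le.mpr h

/-- **`hull(S)` is the LEAST `(R_I)^∼`-submodule (as a set) containing `S`** — LANA §5.2 (d) / Dupuy–Hilado
Rmk. 4.12.1 read on `V`. [cite: LANA2026Report, §5.2 (d) p. 29] -/
theorem isLeast_packetHull (S : Set (PacketAlgebra p k)) :
    IsLeast {M : Set (PacketAlgebra p k) |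
      (∃ N : Submodule (normalizedPacket p k) (PacketAlgebra p k), (N : Set (PacketAlgebra p k)) = M) ∧
        S ⊆ M} (packetHull p k S) := by
  refine ⟨⟨⟨packetSpan p k S, rfl⟩, subset_packetHull p k S⟩, ?_⟩
  rintro M ⟨⟨N, rfl⟩, hSN⟩
  exact packetHull_subset_of_subset_submodule p k hSN

/-! ## Translates `c·(R_I)^∼` are hull-closed -/

/-- The translate `c·(R_I)^∼` of the integral structure by an element `c ∈ V` as an `(R_I)^∼`-submodule of
`V` (the principal submodule generated by `c`; `V` is commutative). [cite: Mochizuki2012, IUTchIV Prop. 1.1 p. 9] -/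
def translateSubmodule (c : PacketAlgebra p k) :
    Submodule (normalizedPacket p k) (PacketAlgebra p k) :=
  Submodule.span (normalizedPacket p k) {c}

/-- The principal submodule generated by `c` is, as a set, the translate `c·(R_I)^∼`.
[cite: Mochizuki2012, IUTchIV Prop. 1.1 p. 9] -/
theorem coe_translateSubmodule (c : PacketAlgebra p k) :
    (translateSubmodule p k c : Set (PacketAlgebra p k)) =
      c • (normalizedPacket p k : Set (PacketAlgebra p k)) := by
  ext x
  rw [translateSubmodule, SetLike.mem_coe, Submodule.mem_span_singleton, Set.mem_smul_set]
  constructor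
  · rintro ⟨r, rfl⟩
    exact ⟨(r : PacketAlgebra p k), r.2, by rw [smul_eq_mul, mul_comm]; rfl⟩
  · rintro ⟨y, hy, rfl⟩
    exact ⟨⟨y, hy⟩, by rw [smul_eq_mul]; exact (mul_comm _ _).trans rfl⟩

/-- **Translates of the integral structure are hull-closed**: `hull(c·(R_I)^∼) = c·(R_I)^∼` (e.g. the sets
`p^λ·(R_I)^∼` of [IUTchIV] Props. 1.1–1.4, realised as `(p^n·⊗h_i)·(R_I)^∼` in `TensorPacketRing.lean`).
[cite: Mochizuki2012, IUTchIII Rmk. 3.9.5 (i) p. 127] -/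
theorem packetHull_smul_normalizedPacket (c : PacketAlgebra p k) :
    packetHull p k (c • (normalizedPacket p k : Set (PacketAlgebra p k))) =
      c • (normalizedPacket p k : Set (PacketAlgebra p k)) := by
  rw [← coe_translateSubmodule, packetHull_coe_submodule]

/-- Hence the hull of any region contained in a translate `c·(R_I)^∼` is contained in it.
[cite: Mochizuki2012, IUTchIII Rmk. 3.9.5 (i) p. 127] -/
theorem packetHull_subset_smul_normalizedPacket {S : Set (PacketAlgebra p k)} {c : PacketAlgebra p k}
    (h : S ⊆ c • (normalizedPacket p k : Set (PacketAlgebra p k))) :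
    packetHull p k S ⊆ c • (normalizedPacket p k : Set (PacketAlgebra p k)) := by
  rw [← packetHull_smul_normalizedPacket p k c]
  exact packetHull_mono p k h

/-- **The Step (v) use of the hull** ([IUTchIV] Thm. 1.10, proof, p. 27–28): if a region `U` lies in a set
`A` (there: `p^{⌊λ−d_I−a_I⌋}·log_p(R_I^×)`, containing the union of possible images) which in turn lies in a
translate `c·(R_I)^∼` (there: `p^{⌊λ−d_I−a_I⌋−b_I}·(R_I)^∼`, second inclusion of Prop. 1.4 (iii)), then
`hull(U) ⊆ c·(R_I)^∼` — "an upper bound on the component of the log-volume of the holomorphic hull … may be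
obtained by computing an upper bound for the log-volume of the right-hand side".
[cite: Mochizuki2012, IUTchIV Thm 1.10 proof Step (v) p.27–28] -/
theorem packetHull_subset_of_subset_of_subset {U A : Set (PacketAlgebra p k)} {c : PacketAlgebra p k}
    (hUA : U ⊆ A) (hA : A ⊆ c • (normalizedPacket p k : Set (PacketAlgebra p k))) :
    packetHull p k U ⊆ c • (normalizedPacket p k : Set (PacketAlgebra p k)) :=
  packetHull_subset_smul_normalizedPacket p k (hUA.trans hA)

/-- The hull of a UNION of regions each contained in the translate `c·(R_I)^∼` is contained in it (the
"union of possible images" of Step (v)). [cite: Mochizuki2012, IUTchIV Thm 1.10 proof Step (v) p.27–28] -/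
theorem packetHull_iUnion_subset {ι : Sort*} {U : ι → Set (PacketAlgebra p k)} {c : PacketAlgebra p k}
    (h : ∀ i, U i ⊆ c • (normalizedPacket p k : Set (PacketAlgebra p k))) :
    packetHull p k (⋃ i, U i) ⊆ c • (normalizedPacket p k : Set (PacketAlgebra p k)) :=
  packetHull_subset_smul_normalizedPacket p k (Set.iUnion_subset h)

/-- `(R_I)^∼` itself is hull-closed: `hull((R_I)^∼) = (R_I)^∼`. [cite: Mochizuki2012, IUTchIII Rmk. 3.9.5 (i) p. 127] -/
theorem packetHull_normalizedPacket :
    packetHull p k (normalizedPacket p k : Set (PacketAlgebra p k)) = normalizedPacket p k := by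
  have h := packetHull_smul_normalizedPacket p k 1
  rwa [one_smul] at h

/-! ## The bridge to the hull on a product of local fields -/

section Bridge

variable {J : Type} (L : J → Type) [∀ j, NontriviallyNormedField (L j)]

/-- `∏_j 𝒪_{L_j}` = LANA's `VC(O)` = the unit polydisc: the same set under its two names in this directory.
[cite: LANA2026Report, §5.2 (c) p. 29] -/
theorem polydisc_one_eq_integralElements :
    polydisc L (fun _ => (1 : ℝ)) = integralElements L := by
  ext x
  rw [mem_polydisc]
  rfl

variable [Fintype J] [∀ j, NormedAlgebra ℚ_[p] (L j)] [∀ j, IsUltrametricDist (L j)] [∀ j, ProperSpace (L j)]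
variable [Fintype I] [DecidableEq I] [Nonempty I] [∀ i, IsUltrametricDist (k i)] [∀ i, ProperSpace (k i)]
variable (ψ : PacketAlgebra p k ≃ₐ[ℚ_[p]] (Π j, L j))

/-- Under a decomposition `ψ`, an element of `(R_I)^∼` goes to an integral element of `⊕_j L_j`.
[cite: Mochizuki2012, IUTchIV Prop. 1.4 (i) p. 13] -/
theorem map_mem_integralElements {x : PacketAlgebra p k} (hx : x ∈ normalizedPacket p k) :
    ψ x ∈ integralElements L := by
  rw [← polydisc_one_eq_integralElements, ← image_normalizedPacket p k L ψ]
  exact ⟨x, hx, rfl⟩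

/-- Under a decomposition `ψ`, an integral element of `⊕_j L_j` comes from `(R_I)^∼`.
[cite: Mochizuki2012, IUTchIV Prop. 1.4 (i) p. 13] -/
theorem symm_mem_normalizedPacket {a : Π j, L j} (ha : a ∈ integralElements L) :
    ψ.symm a ∈ normalizedPacket p k := by
  rw [← polydisc_one_eq_integralElements, ← image_normalizedPacket p k L ψ] at ha
  obtain ⟨x, hx, rfl⟩ := ha
  rw [ψ.symm_apply_apply]
  exact hx

/-- The image under `ψ` of an `(R_I)^∼`-submodule of `V` is a `VC(O)`-submodule of `⊕_j L_j`.
[cite: LANA2026Report, §5.2 (d) p. 29] -/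
theorem isIntegralSubmodule_image (M : Submodule (normalizedPacket p k) (PacketAlgebra p k)) :
    IsIntegralSubmodule L (ψ '' (M : Set (PacketAlgebra p k))) where
  zero_mem := ⟨0, M.zero_mem, map_zero ψ⟩
  add_mem := by
    rintro _ _ ⟨x, hx, rfl⟩ ⟨y, hy, rfl⟩
    exact ⟨x + y, M.add_mem hx hy, map_add ψ x y⟩
  mul_mem := by
    rintro a _ ha ⟨x, hx, rfl⟩
    refine ⟨ψ.symm a * x, ?_, by rw [map_mul, ψ.apply_symm_apply]⟩
    exact M.smul_mem ⟨ψ.symm a, symm_mem_normalizedPacket p k L ψ ha⟩ hx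

/-- The preimage under `ψ` of a `VC(O)`-submodule of `⊕_j L_j` is (the set of) an `(R_I)^∼`-submodule of `V`.
[cite: LANA2026Report, §5.2 (d) p. 29] -/
def comapIntegralSubmodule {M : Set (Π j, L j)} (hM : IsIntegralSubmodule L M) :
    Submodule (normalizedPacket p k) (PacketAlgebra p k) where
  carrier := ψ ⁻¹' M
  zero_mem' := by
    show ψ 0 ∈ M
    rw [map_zero]
    exact hM.zero_mem
  add_mem' := by
    intro x y hx hy
    show ψ (x + y) ∈ M
    rw [map_add]
    exact hM.add_mem hx hy
  smul_mem' := by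
    intro r x hx
    show ψ ((r : PacketAlgebra p k) * x) ∈ M
    rw [map_mul]
    exact hM.mul_mem (map_mem_integralElements p k L ψ r.2) hx

/-- Its underlying set is the preimage. [cite: LANA2026Report, §5.2 (d) p. 29] -/
theorem coe_comapIntegralSubmodule {M : Set (Π j, L j)} (hM : IsIntegralSubmodule L M) :
    (comapIntegralSubmodule p k L ψ hM : Set (PacketAlgebra p k)) = ψ ⁻¹' M := rfl

/-- **THE BRIDGE, LANA form**: under any decomposition `ψ : V ≃ₐ ⊕_j L_j`, the image of the intrinsic hull
is LANA's hull of the image: `ψ(hull(S)) = lanaHull(ψ(S))` (the smallest `VC(O)`-submodule containing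
`ψ(S)`), for EVERY `S ⊆ V`. [cite: LANA2026Report, §5.2 (d) p. 29] -/
theorem image_packetHull_eq_lanaHull (S : Set (PacketAlgebra p k)) :
    ψ '' packetHull p k S = lanaHull L (ψ '' S) := by
  refine le_antisymm ?_ ?_
  · -- `hull(S) ⊆ ψ⁻¹(lanaHull(ψ S))`, a submodule containing `S`
    rw [Set.image_subset_iff]
    have h : S ⊆ (comapIntegralSubmodule p k L ψ (isIntegralSubmodule_lanaHull L (ψ '' S)) :
        Set (PacketAlgebra p k)) := by
      rw [coe_comapIntegralSubmodule, ← Set.image_subset_iff]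
      exact subset_lanaHull L (ψ '' S)
    exact packetHull_subset_of_subset_submodule p k h
  · -- `lanaHull(ψ S) ⊆ ψ(hull S)`, a `VC(O)`-submodule containing `ψ S`
    refine lanaHull_subset L (isIntegralSubmodule_image p k L ψ (packetSpan p k S)) ?_
    exact Set.image_mono (subset_packetHull p k S)

/-- **THE BRIDGE, [IUTchIII] / Dupuy–Hilado form**: for `S ⊆ V` with `ψ(S)` bounded (relatively compact),
`ψ(hull(S)) = holomorphicHull(ψ(S))` — the smallest `λ·𝒪` ([IUTchIII] Rmk. 3.9.5 (i)) = the smallest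
polydisc (Dupuy–Hilado §4.12) containing `ψ(S)` (`LanaHullSpan.lanaHull_eq_holomorphicHull`).
[cite: Mochizuki2012, IUTchIII Rmk. 3.9.5 (i) p. 127] -/
theorem image_packetHull_eq_holomorphicHull {S : Set (PacketAlgebra p k)}
    (hS : Bornology.IsBounded (ψ '' S)) :
    ψ '' packetHull p k S = holomorphicHull L (ψ '' S) := by
  rw [image_packetHull_eq_lanaHull, lanaHull_eq_holomorphicHull L hS]

/-- … equivalently `hull(S) = ψ⁻¹(holomorphicHull(ψ(S)))`: the intrinsic hull is the printed hull pulled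
back along ANY decomposition (so it does not depend on the decomposition).
[cite: DupuyHilado2025, §4.12 p. 16] -/
theorem packetHull_eq_preimage_holomorphicHull {S : Set (PacketAlgebra p k)}
    (hS : Bornology.IsBounded (ψ '' S)) :
    packetHull p k S = ψ ⁻¹' holomorphicHull L (ψ '' S) := by
  rw [← image_packetHull_eq_holomorphicHull p k L ψ hS,
    Set.preimage_image_eq _ ψ.injective]

/-- Under `ψ`, the hull of a region inside a translate `c·(R_I)^∼` is a sub-polydisc of the polydisc
`ψ(c)·∏ 𝒪_{L_j}`: `ψ(hull(S)) ⊆ ψ(c)·∏_j 𝒪_{L_j}`. [cite: DupuyHilado2025, §4.12 p. 16] -/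
theorem image_packetHull_subset_smul_polydisc {S : Set (PacketAlgebra p k)} {c : PacketAlgebra p k}
    (h : S ⊆ c • (normalizedPacket p k : Set (PacketAlgebra p k))) :
    ψ '' packetHull p k S ⊆ ψ c • polydisc L (fun _ => (1 : ℝ)) := by
  rintro _ ⟨x, hx, rfl⟩
  obtain ⟨y, hy, rfl⟩ := Set.mem_smul_set.mp (packetHull_subset_smul_normalizedPacket p k h hx)
  refine Set.mem_smul_set.mpr ⟨ψ y, ?_, by rw [smul_eq_mul, smul_eq_mul, map_mul]⟩
  rw [← image_normalizedPacket p k L ψ]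
  exact ⟨y, hy, rfl⟩

end Bridge

end Literature.IUT.LogVolume

end
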